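/-
Copyright: statement-level skeleton of a published paper (lit-balaban cell, Phase-2 proof seat p39 gen 5). No proof claims
beyond what the kernel checks below.
-/
import Literature.MathematicalPhysics.QuantumFieldTheory.Balaban1983to89.B3CxiDerivativeBound
import Literature.MathematicalPhysics.QuantumFieldTheory.Balaban1983to89.B3CxiTorusBound

/-!
# B3 — T. Bałaban, *(Higgs)₂,₃ quantum fields in a finite volume. III. Renormalization*, CMP **88** (1983) 411–445
[Balaban1983Higgs3], p. 437 [PDF 27]: the printed clause *"and the corresponding inequalities for derivatives"* for the free
propagator — TORUS MEMBER: **|(∂^ξ_νC^ξ_T)(y, y′)| ≤ O(1)·e^{−½ξ|y−y′|}/(ξ|y−y′|)²** for the free propagator C^ξ_T = (−Δ^ξ_T + 1)^{−1}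
of the periodic ξ-lattice T^{(j)}_ξ (`Site P j`, d = 3), uniformly in 0 < ξ ≤ 1 and in the torus as long as its physical period
ξ·N is ≥ 1

statement-level skeleton of published theorems with citation tags; proofs where landed; nothing here is a claim about
the Yang–Mills mass gap

PDF held: `paper:balaban1983-higgs-2-3-quantum-fields-finite-volume` (journal page = PDF page + 410), p. 437 [PDF 27] read in the OCR
text `p0027.txt`.
WHAT IS REPRODUCED: a member of row **B3.Eq3.11-3.17** of `HOME/lit-balaban-r15/ROWS-B3.md` (reader/typer r15, fold owner of B3) —
the p. 437 sentence *"Using the inequalities |C^ξ(y − y′)| ≦ O(1)e^{−½|y−y′|}/|y − y′|, |G^ξ_{j″}(0; y, y′)| ≦ O(1)e^{−δ₀|y−y′|}/|y − y′|,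
and the corresponding inequalities for derivatives, we can estimate (3.16) by a constant"*.  The (3.16) bracket lives on the
torus `T^{(j)}_ξ` (r15's `B3Sect3ScalarSelfEnergy.bracket316`, estimated by seat p20's `B3Bound316.abs_bracket316_le` under
kernel hypotheses of the shape `B·(ξ·supDist)⁻¹·e^{−δξ·supDist}` for the propagators and `B′·((ξ·supDist)²)⁻¹·e^{−δξ·supDist}` for
derivative kernels).  The undifferentiated C^ξ-inequality is PROVED on ξℤ³ (this seat gen 3, `B3CxiUniformBound`; p03's witness
`B3CxiComparisonBound`) and ON THE TORUS (p03 g3, `B3CxiTorusBound.abs_CxiT_le`/`CxiT_hC`, by periodization); the derivative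
inequality is PROVED on ξℤ³ (this seat gen 4, `B3CxiDerivativeBound.abs_pdiffZ_Cxi_three_le`, sup form
`abs_Cxi_succ_sub_three_le_sup`: |C^ξ(x+e_ν) − C^ξ(x)| ≤ 900·ξ⁻¹e^{−ξ|x|_∞/2}/|x|_∞²).  THIS FILE proves the derivative inequality
ON THE TORUS, by the same periodization as p03's `perCxi_le`: for d = 3, 0 < ξ ≤ 1, 1 ≤ ξN (N = `P.sitesPerDir j`), y′ ≠ y and
every direction ν, with s = `supDist y y′` (lattice steps) and the absolute constant B′_T = 900·(1 + 2/(1 − e^{−1/6}))³ ≤ 3037500: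
* `abs_CxiT_shift_sub_le`: |C^ξ_T(y+e_ν, y′) − C^ξ_T(y, y′)| ≤ B′_T·ξ·e^{−½ξs}/(ξs)²  (= B′_T·ξ⁻¹e^{−½ξs}/s²);
* `abs_d1Kernel_CxiT_le`: |(∂^ξ_νC^ξ_T)(y, y′)| ≤ B′_T·((ξs)²)⁻¹·e^{−½ξs}` (r15's `d1Kernel ξ⁻¹ ν` = the kernel of ∂^ξ_ν ∘ C^ξ_T —
  exactly the shape `B′·((ξ·supDist y y′)²)⁻¹·exp(−(½(ξ·supDist y y′)))` of `B3Bound316`'s hypothesis `hM`), with the numeral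
  form `abs_d1Kernel_CxiT_le'` (B′ = 3037500);
* the backward derivative / second-variable versions `abs_CxiT_unshift_sub_le`, `abs_CxiT_shift_right_sub_le`,
  `abs_CxiT_unshift_right_sub_le` (evenness `perCxi_neg` and translation invariance `CxiT_shift_shift`), i.e. the kernels of
  ∂^{ξ*}_ν ∘ C^ξ_T, C^ξ_T ∘ ∂^{ξ*}_ν and C^ξ_T ∘ ∂^ξ_ν obey the same bound; all four at once with the numeral: `abs_diff_CxiT_le_all`.
Tools (§1, reusable for any decreasing profile): `cosetPt_ne_zero`, `supn_le_supn_cosetPt`, `gap_cosetPt` and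
**`profile_cosetPt_le`**: e^{−½ξ|z+Nn|_∞}/(ξ|z+Nn|_∞)^p ≤ e^{−½ξ|z|_∞}/(ξ|z|_∞)^p·Π_μ q^{(|n_μ|−1)⁺}, q = e^{−ξN/6}, for the minimal
representative z (2|z_μ| ≤ N) and every power p — p03's argument inside `Cxi_cosetPt_le`, isolated; (§2) the coset difference term
`abs_Cxi_cosetPt_succ_sub_le`; (§3) the periodization `perCxi_add_unitVec_sub`/`abs_perCxi_add_unitVec_sub_le` (Σ_{n∈ℤ³}Π_μq^{(|n_μ|−1)⁺}
≤ (1 + 2/(1−q))³ ≤ (1 + 2/(1−e^{−1/6}))³, p03's `sum_prod_le`); (§4) the torus statements.  The hypothesis ξN ≥ 1 is the same as in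
`B3CxiTorusBound` (zero mode).  Mathlib + the cited tree files only; theorems only, no new definitions, no named facts; standard
axioms.  Unit `lit-balaban-p39-g5` (Phase-2 proof seat p39, gen 5), HOME `run/shared/lean/pub/lit-balaban/`, 2026-08-21.
-/

open scoped BigOperators
open Real Set

namespace Literature.MathematicalPhysics.QuantumFieldTheory.Balaban1983to89.B3CxiTorusDerivativeBound

open B3Sect3VectorSelfEnergy B3CxiPropagator B3CxiComparisonBound B3CxiUniformBound B3CxiDerivativeBound B3CxiTorusBound
  B3Sect3ScalarSelfEnergy B3TorusRadialSums LatticeFieldCalculus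

noncomputable section

/-! ## 1. Coset geometry: the decay profile at z + N·n versus at the minimal representative z -/

section Coset

variable {ξ : ℝ}

/-- kernel: the two sup norms of the tree agree, `supn y = (supNorm y : ℝ)`. [cite: Balaban1983Higgs3, (3.16) p.437] -/
theorem supn_eq_supNorm (y : ZSite 3) : supn y = (supNorm y : ℝ) := rfl

/-- kernel: (z + e_ν) + N·n = (z + N·n) + e_ν. [cite: Balaban1983Higgs3, (3.16) p.437] -/
theorem cosetPt_add_unitVec {d : ℕ} (N : ℕ) (z n : ZSite d) (ν : Fin d) :
    cosetPt N (z + unitVec ν) n = cosetPt N z n + unitVec ν := by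
  simp only [cosetPt]; abel

/-- kernel: the triangle inequality N|n_μ| ≤ |(z + N·n)_μ| + |z_μ| in every direction. [cite: Balaban1983Higgs3, (3.16) p.437] -/
theorem mul_natAbs_le_cosetPt {d : ℕ} (N : ℕ) (z n : ZSite d) (μ : Fin d) :
    N * (n μ).natAbs ≤ (cosetPt N z n μ).natAbs + (z μ).natAbs := by
  have h1 : ((N : ℤ) * n μ).natAbs = N * (n μ).natAbs := by rw [Int.natAbs_mul, Int.natAbs_natCast]
  have h2 := Int.natAbs_sub_le (cosetPt N z n μ) (z μ)
  rw [cosetPt_apply, add_sub_cancel_left, h1] at h2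
  rw [cosetPt_apply]
  exact h2

/-- kernel: for the minimal representative (2|z_μ| ≤ N), |z_μ| ≤ |(z + N·n)_μ| in every direction.
[cite: Balaban1983Higgs3, (3.16) p.437] -/
theorem natAbs_le_cosetPt {d : ℕ} {N : ℕ} {z : ZSite d} (hzN : ∀ μ, 2 * (z μ).natAbs ≤ N) (n : ZSite d) (μ : Fin d) :
    (z μ).natAbs ≤ (cosetPt N z n μ).natAbs := by
  by_cases hn : n μ = 0
  · have : cosetPt N z n μ = z μ := by rw [cosetPt_apply, hn, mul_zero, add_zero]
    rw [this]
  · have h4 : 1 ≤ (n μ).natAbs := Int.natAbs_pos.2 hn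
    have h5 : N ≤ N * (n μ).natAbs := Nat.le_mul_of_pos_right N h4
    have h2 := hzN μ
    have h3 := mul_natAbs_le_cosetPt N z n μ
    omega

/-- kernel: a nonzero minimal representative has only nonzero coset points, z + N·n ≠ 0. [cite: Balaban1983Higgs3, (3.16) p.437] -/
theorem cosetPt_ne_zero {d : ℕ} {N : ℕ} {z : ZSite d} (hz : z ≠ 0) (hzN : ∀ μ, 2 * (z μ).natAbs ≤ N) (n : ZSite d) :
    cosetPt N z n ≠ 0 := by
  intro h0
  apply hz
  funext μ
  have h1 : (cosetPt N z n μ).natAbs = 0 := by rw [h0]; rfl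
  have h2 := natAbs_le_cosetPt hzN n μ
  rw [h1] at h2
  exact Int.natAbs_eq_zero.1 (Nat.le_zero.1 h2)

/-- kernel: |z|_∞ ≤ |z + N·n|_∞ for the minimal representative. [cite: Balaban1983Higgs3, (3.16) p.437] -/
theorem supn_le_supn_cosetPt {N : ℕ} {z : ZSite 3} (hzN : ∀ μ, 2 * (z μ).natAbs ≤ N) (n : ZSite 3) :
    supn z ≤ supn (cosetPt N z n) := by
  rw [← supZ_three, ← supZ_three]
  exact supZ_mono fun μ => natAbs_le_cosetPt hzN n μ

/-- kernel: the gain N(|n_μ| − 1)⁺ ≤ |z + N·n|_∞ − |z|_∞ in every direction. [cite: Balaban1983Higgs3, (3.16) p.437] -/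
theorem gap_cosetPt {N : ℕ} {z : ZSite 3} (hzN : ∀ μ, 2 * (z μ).natAbs ≤ N) (n : ZSite 3) (μ : Fin 3) :
    (N : ℝ) * (((n μ).natAbs - 1 : ℕ) : ℝ) ≤ supn (cosetPt N z n) - supn z := by
  set x := cosetPt N z n with hx
  have hsz : supn z ≤ supn x := supn_le_supn_cosetPt hzN n
  by_cases hk : (n μ).natAbs = 0
  · rw [hk]
    norm_num
    linarith
  · have hk1 : 1 ≤ (n μ).natAbs := Nat.one_le_iff_ne_zero.2 hk
    rw [Nat.cast_sub hk1, Nat.cast_one]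
    have h6 : (N : ℝ) * (n μ).natAbs ≤ (x μ).natAbs + (z μ).natAbs := by exact_mod_cast mul_natAbs_le_cosetPt N z n μ
    have h8 : ((x μ).natAbs : ℝ) ≤ supn x := by rw [← supZ_three]; exact natAbs_le_supZ x μ
    have h9 : ((z μ).natAbs : ℝ) ≤ supn z := by rw [← supZ_three]; exact natAbs_le_supZ z μ
    have hszN : 2 * supn z ≤ N := by rw [← supZ_three]; exact two_mul_supZ_le hzN
    nlinarith

/-- kernel: the exponential factor splits off the coset gain, e^{−½ξ|z+N·n|_∞} ≤ e^{−½ξ|z|_∞}·Π_μ q^{(|n_μ|−1)⁺}, q = e^{−ξN/6}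
(ξ ≥ 0). [cite: Balaban1983Higgs3, (3.16) p.437] -/
theorem exp_cosetPt_le (hξ : 0 ≤ ξ) {N : ℕ} {z : ZSite 3} (hzN : ∀ μ, 2 * (z μ).natAbs ≤ N) (n : ZSite 3) :
    Real.exp (-(1 / 2 * (ξ * supn (cosetPt N z n)))) ≤
      Real.exp (-(1 / 2 * (ξ * supn z))) * ∏ μ : Fin 3, Real.exp (-(ξ * N / 6)) ^ ((n μ).natAbs - 1) := by
  set x := cosetPt N z n with hx
  have hprod : ∏ μ : Fin 3, Real.exp (-(ξ * N / 6)) ^ ((n μ).natAbs - 1) =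
      Real.exp (∑ μ : Fin 3, (((n μ).natAbs - 1 : ℕ) : ℝ) * (-(ξ * N / 6))) := by
    rw [Real.exp_sum]
    exact Finset.prod_congr rfl fun μ _ => (Real.exp_nat_mul _ _).symm
  rw [hprod, ← Real.exp_add]
  apply Real.exp_le_exp.2
  have hsum : (N : ℝ) * ∑ μ : Fin 3, (((n μ).natAbs - 1 : ℕ) : ℝ) ≤ 3 * (supn x - supn z) := by
    rw [Finset.mul_sum]
    calc ∑ μ : Fin 3, (N : ℝ) * (((n μ).natAbs - 1 : ℕ) : ℝ) ≤ ∑ _μ : Fin 3, (supn x - supn z) :=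
          Finset.sum_le_sum fun μ _ => gap_cosetPt hzN n μ
      _ = 3 * (supn x - supn z) := by
          rw [Finset.sum_const, Finset.card_univ, Fintype.card_fin, nsmul_eq_mul]; norm_num
  have hre : ∑ μ : Fin 3, (((n μ).natAbs - 1 : ℕ) : ℝ) * (-(ξ * N / 6)) =
      -(ξ / 6) * ((N : ℝ) * ∑ μ : Fin 3, (((n μ).natAbs - 1 : ℕ) : ℝ)) := by
    rw [Finset.mul_sum, Finset.mul_sum]
    exact Finset.sum_congr rfl fun μ _ => by ring
  rw [hre]
  nlinarith [mul_le_mul_of_nonneg_left hsum hξ]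

/-- **The profile transfer** (p03's argument of `B3CxiTorusBound.Cxi_cosetPt_le`, isolated for every power p): for ξ > 0, a nonzero
minimal representative z (2|z_μ| ≤ N) and every n ∈ ℤ³,
e^{−½ξ|z+N·n|_∞}/(ξ|z+N·n|_∞)^p ≤ e^{−½ξ|z|_∞}/(ξ|z|_∞)^p · Π_μ q^{(|n_μ|−1)⁺}, q = e^{−ξN/6}. [cite: Balaban1983Higgs3, (3.16) p.437] -/
theorem profile_cosetPt_le (hξ : 0 < ξ) {N : ℕ} {z : ZSite 3} (hz : z ≠ 0) (hzN : ∀ μ, 2 * (z μ).natAbs ≤ N)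
    (n : ZSite 3) (p : ℕ) :
    Real.exp (-(1 / 2 * (ξ * supn (cosetPt N z n)))) / (ξ * supn (cosetPt N z n)) ^ p ≤
      Real.exp (-(1 / 2 * (ξ * supn z))) / (ξ * supn z) ^ p *
        ∏ μ : Fin 3, Real.exp (-(ξ * N / 6)) ^ ((n μ).natAbs - 1) := by
  set x := cosetPt N z n with hx
  have hzpos : 0 < supn z := lt_of_lt_of_le one_pos (one_le_supn hz)
  have hξz : 0 < ξ * supn z := mul_pos hξ hzpos
  have hsz : supn z ≤ supn x := supn_le_supn_cosetPt hzN n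
  have hpow : (ξ * supn z) ^ p ≤ (ξ * supn x) ^ p :=
    pow_le_pow_left₀ hξz.le (mul_le_mul_of_nonneg_left hsz hξ.le) p
  have hP : 0 ≤ ∏ μ : Fin 3, Real.exp (-(ξ * N / 6)) ^ ((n μ).natAbs - 1) :=
    Finset.prod_nonneg fun μ _ => pow_nonneg (Real.exp_pos _).le _
  have key : Real.exp (-(1 / 2 * (ξ * supn x))) / (ξ * supn x) ^ p ≤
      (Real.exp (-(1 / 2 * (ξ * supn z))) * ∏ μ : Fin 3, Real.exp (-(ξ * N / 6)) ^ ((n μ).natAbs - 1)) /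
        (ξ * supn z) ^ p :=
    div_le_div₀ (mul_nonneg (Real.exp_pos _).le hP) (exp_cosetPt_le hξ.le hzN n) (pow_pos hξz p) hpow
  calc _ ≤ _ := key
    _ = _ := by ring

end Coset

/-! ## 2. The coset difference term -/

section Term

variable {ξ : ℝ}

/-- **The coset difference term** (d = 3, 0 < ξ ≤ 1): for a nonzero minimal representative z (2|z_μ| ≤ N), every n ∈ ℤ³ and
every direction ν, with x = z + N·n:
|C^ξ(x + e_ν) − C^ξ(x)| ≤ 900·ξ·(e^{−½ξ|z|_∞}/(ξ|z|_∞)²)·Π_μ q^{(|n_μ|−1)⁺}, q = e^{−ξN/6}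
(this seat's gen-4 sup-form difference bound `abs_Cxi_succ_sub_three_le_sup` at x, transferred to z by `profile_cosetPt_le`).
[cite: Balaban1983Higgs3, (3.16) p.437] -/
theorem abs_Cxi_cosetPt_succ_sub_le (hξ : 0 < ξ) (hξ1 : ξ ≤ 1) {N : ℕ} {z : ZSite 3} (hz : z ≠ 0)
    (hzN : ∀ μ, 2 * (z μ).natAbs ≤ N) (n : ZSite 3) (ν : Fin 3) :
    |Cxi 3 ξ (cosetPt N z n + unitVec ν) - Cxi 3 ξ (cosetPt N z n)| ≤
      900 * ξ * (Real.exp (-(1 / 2 * (ξ * supn z))) / (ξ * supn z) ^ 2) *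
        ∏ μ : Fin 3, Real.exp (-(ξ * N / 6)) ^ ((n μ).natAbs - 1) := by
  set x := cosetPt N z n with hx
  have hx0 : x ≠ 0 := cosetPt_ne_zero hz hzN n
  have h := abs_Cxi_succ_sub_three_le_sup hξ hξ1 x hx0 ν
  have hxpos : 0 < supn x := lt_of_lt_of_le one_pos (one_le_supn hx0)
  -- rewrite gen 4's bound in the profile form 900·ξ·e^{−½ξ|x|_∞}/(ξ|x|_∞)²
  have hre : 900 * ξ⁻¹ * Real.exp (-(ξ * supNorm x / 2)) / (supNorm x : ℝ) ^ 2 =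
      900 * ξ * (Real.exp (-(1 / 2 * (ξ * supn x))) / (ξ * supn x) ^ 2) := by
    rw [← supn_eq_supNorm]
    have e1 : -(ξ * supn x / 2) = -(1 / 2 * (ξ * supn x)) := by ring
    rw [e1]
    field_simp
  rw [hre] at h
  refine h.trans ?_
  rw [mul_assoc (900 * ξ)]
  exact mul_le_mul_of_nonneg_left (profile_cosetPt_le hξ hz hzN n 2) (by positivity)

end Term

/-! ## 3. The periodization: Σ'_n [C^ξ(z + e_ν + N·n) − C^ξ(z + N·n)] -/

section Periodization

variable {ξ : ℝ}

/-- kernel: e^{−1/6} ≤ 6/7 (from 1 + 1/6 ≤ e^{1/6}). [folklore] -/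
private theorem exp_neg_sixth_le : Real.exp (-(1 / 6)) ≤ 6 / 7 := by
  have h := Real.add_one_le_exp (1 / 6 : ℝ)
  rw [Real.exp_neg, inv_le_comm₀ (Real.exp_pos _) (by norm_num)]
  linarith

/-- kernel: e^{−1/6} < 1. [folklore] -/
private theorem exp_neg_sixth_lt_one' : Real.exp (-(1 / 6)) < 1 := lt_of_le_of_lt exp_neg_sixth_le (by norm_num)

/-- kernel: the absolute constant B′_T = 900·(1 + 2/(1 − e^{−1/6}))³ is at most 900·15³ = 3037500. [folklore] -/
private theorem derivTorusConst_le : 900 * (1 + 2 / (1 - Real.exp (-(1 / 6)))) ^ 3 ≤ 3037500 := by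
  have h1 : 1 - Real.exp (-(1 / 6)) ≥ 1 / 7 := by linarith [exp_neg_sixth_le]
  have h2 : 2 / (1 - Real.exp (-(1 / 6))) ≤ 14 := by
    rw [div_le_iff₀ (by linarith)]; linarith
  have h3 : 0 ≤ 1 + 2 / (1 - Real.exp (-(1 / 6))) := by
    have : 0 < 1 - Real.exp (-(1 / 6)) := by linarith
    positivity
  have h4 : (1 + 2 / (1 - Real.exp (-(1 / 6)))) ^ 3 ≤ 15 ^ 3 := pow_le_pow_left₀ h3 (by linarith) 3
  nlinarith

/-- **The periodization of the difference**: (Σ'_n C^ξ)(z + e_ν) − (Σ'_n C^ξ)(z) = Σ'_n [C^ξ(z + N·n + e_ν) − C^ξ(z + N·n)]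
(both coset sums converge, r15's `summable_Cxi`). [cite: Balaban1983Higgs3, (3.16) p.437] -/
theorem perCxi_add_unitVec_sub {d : ℕ} (hξ : 0 < ξ) {N : ℕ} (hN : N ≠ 0) (z : ZSite d) (ν : Fin d) :
    perCxi d ξ N (z + unitVec ν) - perCxi d ξ N z =
      ∑' n : ZSite d, (Cxi d ξ (cosetPt N z n + unitVec ν) - Cxi d ξ (cosetPt N z n)) := by
  unfold perCxi
  simp_rw [cosetPt_add_unitVec]
  have ha : Summable fun n : ZSite d => Cxi d ξ (cosetPt N z n + unitVec ν) := by
    have h := summable_coset (d := d) hξ hN (z + unitVec ν)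
    simp_rw [cosetPt_add_unitVec] at h
    exact h
  exact (ha.tsum_sub (summable_coset hξ hN z)).symm

/-- **The periodization bound for the difference** (d = 3): for 0 < ξ ≤ 1, ξN ≥ 1, z ≠ 0 minimal (2|z_μ| ≤ N) and every ν,
|(Σ'_nC^ξ)(z + e_ν) − (Σ'_nC^ξ)(z)| ≤ B′_T·ξ·e^{−½ξ|z|_∞}/(ξ|z|_∞)², B′_T = 900·(1 + 2/(1 − e^{−1/6}))³ (termwise `abs_Cxi_cosetPt_succ_sub_le`,
then Σ_{n∈ℤ³}Π_μ q^{(|n_μ|−1)⁺} ≤ (1 + 2/(1−q))³, p03's `sum_prod_le`, and q = e^{−ξN/6} ≤ e^{−1/6}). [cite: Balaban1983Higgs3, (3.16) p.437] -/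
theorem abs_perCxi_add_unitVec_sub_le {d : ℕ} (hd : d = 3) (hξ : 0 < ξ) (hξ1 : ξ ≤ 1) {N : ℕ} (hN : 1 ≤ ξ * N)
    {z : ZSite d} (hz : z ≠ 0) (hzN : ∀ μ, 2 * (z μ).natAbs ≤ N) (ν : Fin d) :
    |perCxi d ξ N (z + unitVec ν) - perCxi d ξ N z| ≤
      900 * (1 + 2 / (1 - Real.exp (-(1 / 6)))) ^ 3 * ξ *
        (Real.exp (-(1 / 2 * (ξ * supZ z))) / (ξ * supZ z) ^ 2) := by
  subst hd
  rw [supZ_three]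
  have hN0 : N ≠ 0 := by
    rintro rfl
    norm_num at hN
  set q : ℝ := Real.exp (-(ξ * N / 6)) with hq
  have hq0 : 0 ≤ q := (Real.exp_pos _).le
  have hq1 : q ≤ Real.exp (-(1 / 6)) := Real.exp_le_exp.2 (by linarith)
  have hq1' : q < 1 := lt_of_le_of_lt hq1 exp_neg_sixth_lt_one'
  have hzpos : 0 < supn z := lt_of_lt_of_le one_pos (one_le_supn hz)
  set B : ℝ := 900 * ξ * (Real.exp (-(1 / 2 * (ξ * supn z))) / (ξ * supn z) ^ 2) with hB
  have hB0 : 0 ≤ B := by positivity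
  have hS0 : 0 ≤ 1 + 2 / (1 - q) := by
    have : 0 < 1 - q := by linarith
    positivity
  have hS : (1 + 2 / (1 - q)) ^ 3 ≤ (1 + 2 / (1 - Real.exp (-(1 / 6)))) ^ 3 := by
    refine pow_le_pow_left₀ hS0 ?_ 3
    have h1 : 0 < 1 - Real.exp (-(1 / 6)) := by linarith [exp_neg_sixth_lt_one']
    have h2 : 2 / (1 - q) ≤ 2 / (1 - Real.exp (-(1 / 6))) :=
      div_le_div_of_nonneg_left (by norm_num) h1 (by linarith)
    linarith
  set a : ZSite 3 → ℝ := fun n => Cxi 3 ξ (cosetPt N z n + unitVec ν) - Cxi 3 ξ (cosetPt N z n) with ha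
  have hsa : Summable a := by
    have h1 : Summable fun n : ZSite 3 => Cxi 3 ξ (cosetPt N z n + unitVec ν) := by
      have h := summable_coset (d := 3) hξ hN0 (z + unitVec ν)
      simp_rw [cosetPt_add_unitVec] at h
      exact h
    exact h1.sub (summable_coset hξ hN0 z)
  have hF : ∀ F : Finset (ZSite 3), ∑ n ∈ F, |a n| ≤ B * (1 + 2 / (1 - q)) ^ 3 := by
    intro F
    calc ∑ n ∈ F, |a n| ≤ ∑ n ∈ F, B * ∏ μ : Fin 3, q ^ ((n μ).natAbs - 1) :=
          Finset.sum_le_sum fun n _ => abs_Cxi_cosetPt_succ_sub_le hξ hξ1 hz hzN n ν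
      _ = B * ∑ n ∈ F, ∏ μ : Fin 3, q ^ ((n μ).natAbs - 1) := by rw [Finset.mul_sum]
      _ ≤ B * (1 + 2 / (1 - q)) ^ 3 := mul_le_mul_of_nonneg_left (sum_prod_le hq0 hq1' F) hB0
  have habs : ∑' n, |a n| ≤ B * (1 + 2 / (1 - q)) ^ 3 :=
    tsum_le_of_sum_le' (mul_nonneg hB0 (pow_nonneg hS0 3)) hF
  rw [perCxi_add_unitVec_sub hξ hN0 z ν]
  have hle1 : ∑' n, a n ≤ ∑' n, |a n| := Summable.tsum_le_tsum (fun n => le_abs_self _) hsa hsa.abs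
  have hle2 : ∑' n, -a n ≤ ∑' n, |a n| := Summable.tsum_le_tsum (fun n => neg_le_abs _) hsa.neg hsa.abs
  rw [tsum_neg] at hle2
  calc |∑' n, a n| ≤ ∑' n, |a n| := abs_le.2 ⟨by linarith, hle1⟩
    _ ≤ B * (1 + 2 / (1 - q)) ^ 3 := habs
    _ ≤ B * (1 + 2 / (1 - Real.exp (-(1 / 6)))) ^ 3 := mul_le_mul_of_nonneg_left hS hB0
    _ = _ := by simp only [hB]; ring

end Periodization

/-! ## 4. The derivative bound on the three-dimensional torus -/

section Torus

variable {P : Params} {j : ℕ}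

/-- kernel: `(y − e_ν) + e_ν = y` on the torus. [folklore] -/
private theorem shift_unshift_site (y : Site P j) (ν : Fin P.d) : (y.unshift ν).shift ν = y :=
  (shiftEquiv (P := P) (j := j) ν).apply_symm_apply y

/-- kernel: translation invariance read on the second variable, C^ξ_T(y, y′ + e_ν) = C^ξ_T(y − e_ν, y′).
[cite: Balaban1983Higgs3, (3.16) p.437] -/
theorem CxiT_shift_right (ξ : ℝ) (y y' : Site P j) (ν : Fin P.d) :
    CxiT ξ y (y'.shift ν) = CxiT ξ (y.unshift ν) y' := by
  conv_lhs => rw [← shift_unshift_site y ν]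
  exact CxiT_shift_shift ξ (y.unshift ν) y' ν

/-- kernel: C^ξ_T(y, y′ − e_ν) = C^ξ_T(y + e_ν, y′). [cite: Balaban1983Higgs3, (3.16) p.437] -/
theorem CxiT_unshift_right (ξ : ℝ) (y y' : Site P j) (ν : Fin P.d) :
    CxiT ξ y (y'.unshift ν) = CxiT ξ (y.shift ν) y' := by
  have h := CxiT_shift_shift ξ y (y'.unshift ν) ν
  rw [shift_unshift_site] at h
  exact h.symm

/-- **[Balaban1983Higgs3] p. 437, "the corresponding inequalities for derivatives" for C^ξ ON THE TORUS — PROVED** (d = 3,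
0 < ξ ≤ 1, physical period ξN ≥ 1, y′ ≠ y, every direction ν): the forward difference of the torus free propagator in its first
variable obeys |C^ξ_T(y + e_ν, y′) − C^ξ_T(y, y′)| ≤ B′_T·ξ·e^{−½ξ|y−y′|_∞}/(ξ|y−y′|_∞)² with |y − y′|_∞ = `supDist y y′` lattice steps
and the absolute constant B′_T = 900·(1 + 2/(1 − e^{−1/6}))³. [cite: Balaban1983Higgs3, (3.16) p.437] -/
theorem abs_CxiT_shift_sub_le (hd : P.d = 3) {ξ : ℝ} (hξ : 0 < ξ) (hξ1 : ξ ≤ 1) (hN : 1 ≤ ξ * (P.sitesPerDir j : ℝ))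
    {y y' : Site P j} (hne : y' ≠ y) (ν : Fin P.d) :
    |CxiT ξ (y.shift ν) y' - CxiT ξ y y'| ≤
      900 * (1 + 2 / (1 - Real.exp (-(1 / 6)))) ^ 3 * ξ *
        (Real.exp (-(1 / 2 * (ξ * (supDist y y' : ℝ)))) / (ξ * (supDist y y' : ℝ)) ^ 2) := by
  have hz : liftZ y y' ≠ 0 := fun h => hne ((liftZ_eq_zero_iff y y').1 h).symm
  have h := abs_perCxi_add_unitVec_sub_le hd hξ hξ1 hN hz (two_mul_natAbs_liftZ_le y y') ν
  rw [← supDist_eq_supZ] at h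
  rw [CxiT_shift]
  exact h

/-- **Backward difference** in the first variable: for y′ ≠ y, |C^ξ_T(y − e_ν, y′) − C^ξ_T(y, y′)| obeys the same bound in terms of
`supDist y y′` (C^ξ_T is even, `perCxi_neg`: the backward difference at ỹ − ỹ′ is the forward difference at the minimal
representative −(ỹ − ỹ′), of the same sup norm). [cite: Balaban1983Higgs3, (3.16) p.437] -/
theorem abs_CxiT_unshift_sub_le (hd : P.d = 3) {ξ : ℝ} (hξ : 0 < ξ) (hξ1 : ξ ≤ 1) (hN : 1 ≤ ξ * (P.sitesPerDir j : ℝ))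
    {y y' : Site P j} (hne : y' ≠ y) (ν : Fin P.d) :
    |CxiT ξ (y.unshift ν) y' - CxiT ξ y y'| ≤
      900 * (1 + 2 / (1 - Real.exp (-(1 / 6)))) ^ 3 * ξ *
        (Real.exp (-(1 / 2 * (ξ * (supDist y y' : ℝ)))) / (ξ * (supDist y y' : ℝ)) ^ 2) := by
  have hz : liftZ y y' ≠ 0 := fun h => hne ((liftZ_eq_zero_iff y y').1 h).symm
  have hz' : -liftZ y y' ≠ 0 := neg_ne_zero.mpr hz
  have hzN' : ∀ μ, 2 * ((-liftZ y y') μ).natAbs ≤ P.sitesPerDir j := fun μ => by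
    rw [Pi.neg_apply, Int.natAbs_neg]; exact two_mul_natAbs_liftZ_le y y' μ
  have h := abs_perCxi_add_unitVec_sub_le hd hξ hξ1 hN hz' hzN' ν
  have hsupZ : supZ (-liftZ y y') = supZ (liftZ y y') := by
    unfold supZ; simp only [Pi.neg_apply, Int.natAbs_neg]
  rw [hsupZ, ← supDist_eq_supZ] at h
  have e1 : CxiT ξ (y.unshift ν) y' = perCxi P.d ξ (P.sitesPerDir j) (-liftZ y y' + unitVec ν) := by
    rw [CxiT_unshift, ← perCxi_neg ξ (P.sitesPerDir j) (-liftZ y y' + unitVec ν)]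
    congr 1
    abel
  have e2 : CxiT ξ y y' = perCxi P.d ξ (P.sitesPerDir j) (-liftZ y y') := by
    rw [perCxi_neg]; rfl
  rw [e1, e2]
  exact h

/-- **Forward difference in the second variable** (the kernel of C^ξ_T ∘ ∂^{ξ*}_ν up to the factor ξ⁻¹, r15's `kernelOp_pdiffAdj`
reading): for y′ ≠ y, |C^ξ_T(y, y′ + e_ν) − C^ξ_T(y, y′)| obeys the same bound (`CxiT_shift_right`). [cite: Balaban1983Higgs3, (3.16) p.437] -/
theorem abs_CxiT_shift_right_sub_le (hd : P.d = 3) {ξ : ℝ} (hξ : 0 < ξ) (hξ1 : ξ ≤ 1) (hN : 1 ≤ ξ * (P.sitesPerDir j : ℝ))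
    {y y' : Site P j} (hne : y' ≠ y) (ν : Fin P.d) :
    |CxiT ξ y (y'.shift ν) - CxiT ξ y y'| ≤
      900 * (1 + 2 / (1 - Real.exp (-(1 / 6)))) ^ 3 * ξ *
        (Real.exp (-(1 / 2 * (ξ * (supDist y y' : ℝ)))) / (ξ * (supDist y y' : ℝ)) ^ 2) := by
  rw [CxiT_shift_right]
  exact abs_CxiT_unshift_sub_le hd hξ hξ1 hN hne ν

/-- **Backward difference in the second variable** (the kernel of C^ξ_T ∘ ∂^ξ_ν up to the factor ξ⁻¹): for y′ ≠ y,
|C^ξ_T(y, y′ − e_ν) − C^ξ_T(y, y′)| obeys the same bound (`CxiT_unshift_right`). [cite: Balaban1983Higgs3, (3.16) p.437] -/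
theorem abs_CxiT_unshift_right_sub_le (hd : P.d = 3) {ξ : ℝ} (hξ : 0 < ξ) (hξ1 : ξ ≤ 1) (hN : 1 ≤ ξ * (P.sitesPerDir j : ℝ))
    {y y' : Site P j} (hne : y' ≠ y) (ν : Fin P.d) :
    |CxiT ξ y (y'.unshift ν) - CxiT ξ y y'| ≤
      900 * (1 + 2 / (1 - Real.exp (-(1 / 6)))) ^ 3 * ξ *
        (Real.exp (-(1 / 2 * (ξ * (supDist y y' : ℝ)))) / (ξ * (supDist y y' : ℝ)) ^ 2) := by
  rw [CxiT_unshift_right]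
  exact abs_CxiT_shift_sub_le hd hξ hξ1 hN hne ν

/-- **The kernel of ∂^ξ_ν ∘ C^ξ_T** (r15's `d1Kernel ξ⁻¹ ν`), in the shape `B′·((ξ·supDist)²)⁻¹·e^{−½ξ·supDist}` of `B3Bound316`'s
derivative hypothesis `hM` (δ = ½): for d = 3, 0 < ξ ≤ 1, ξN ≥ 1 and y′ ≠ y,
|(∂^ξ_νC^ξ_T)(y, y′)| ≤ B′_T·((ξ·supDist y y′)²)⁻¹·e^{−½ξ·supDist y y′}, B′_T = 900·(1 + 2/(1 − e^{−1/6}))³. [cite: Balaban1983Higgs3, (3.16) p.437] -/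
theorem abs_d1Kernel_CxiT_le (hd : P.d = 3) {ξ : ℝ} (hξ : 0 < ξ) (hξ1 : ξ ≤ 1) (hN : 1 ≤ ξ * (P.sitesPerDir j : ℝ))
    {y y' : Site P j} (hne : y' ≠ y) (ν : Fin P.d) :
    |d1Kernel ξ⁻¹ ν (CxiT ξ) y y'| ≤
      900 * (1 + 2 / (1 - Real.exp (-(1 / 6)))) ^ 3 * ((ξ * (supDist y y' : ℝ)) ^ 2)⁻¹ *
        Real.exp (-(1 / 2 * (ξ * (supDist y y' : ℝ)))) := by
  have h := abs_CxiT_shift_sub_le hd hξ hξ1 hN hne ν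
  have hξ0 : ξ ≠ 0 := hξ.ne'
  have hs : (0 : ℝ) < (supDist y y' : ℝ) := by
    have h0 : supDist y y' ≠ 0 := fun h0 => hne (((supDist_eq_zero_iff y y').mp h0).symm)
    exact_mod_cast Nat.pos_of_ne_zero h0
  have hs0 : (supDist y y' : ℝ) ≠ 0 := hs.ne'
  unfold d1Kernel
  rw [abs_mul, abs_of_pos (inv_pos.mpr hξ)]
  calc ξ⁻¹ * |CxiT ξ (y.shift ν) y' - CxiT ξ y y'|
      ≤ ξ⁻¹ * (900 * (1 + 2 / (1 - Real.exp (-(1 / 6)))) ^ 3 * ξ *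
          (Real.exp (-(1 / 2 * (ξ * (supDist y y' : ℝ)))) / (ξ * (supDist y y' : ℝ)) ^ 2)) :=
        mul_le_mul_of_nonneg_left h (inv_pos.mpr hξ).le
    _ = _ := by field_simp

/-- The same with the numeral constant B′ = 3037500 ≥ B′_T (`derivTorusConst_le`) — the hypothesis shape
`|K y y′| ≤ B′ * ((ξ * supDist y y′) ^ 2)⁻¹ * exp (−(1/2 * (ξ * supDist y y′)))` verbatim. [cite: Balaban1983Higgs3, (3.16) p.437] -/
theorem abs_d1Kernel_CxiT_le' (hd : P.d = 3) {ξ : ℝ} (hξ : 0 < ξ) (hξ1 : ξ ≤ 1) (hN : 1 ≤ ξ * (P.sitesPerDir j : ℝ))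
    {y y' : Site P j} (hne : y' ≠ y) (ν : Fin P.d) :
    |d1Kernel ξ⁻¹ ν (CxiT ξ) y y'| ≤
      3037500 * ((ξ * (supDist y y' : ℝ)) ^ 2)⁻¹ * Real.exp (-(1 / 2 * (ξ * (supDist y y' : ℝ)))) := by
  refine (abs_d1Kernel_CxiT_le hd hξ hξ1 hN hne ν).trans ?_
  have h0 : 0 ≤ ((ξ * (supDist y y' : ℝ)) ^ 2)⁻¹ * Real.exp (-(1 / 2 * (ξ * (supDist y y' : ℝ)))) := by positivity
  nlinarith [mul_le_mul_of_nonneg_right derivTorusConst_le h0]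

/-- **All four first-order difference kernels of C^ξ_T at once**, divided by ξ (i.e. the kernels of ∂^ξ_ν∘C, ∂^{ξ*}_ν∘C, C∘∂^{ξ*}_ν,
C∘∂^ξ_ν): each is bounded by 3037500·((ξ·supDist y y′)²)⁻¹·e^{−½ξ·supDist y y′} for y′ ≠ y (d = 3, 0 < ξ ≤ 1, ξN ≥ 1).
[cite: Balaban1983Higgs3, (3.16) p.437] -/
theorem abs_diff_CxiT_le_all (hd : P.d = 3) {ξ : ℝ} (hξ : 0 < ξ) (hξ1 : ξ ≤ 1) (hN : 1 ≤ ξ * (P.sitesPerDir j : ℝ))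
    {y y' : Site P j} (hne : y' ≠ y) (ν : Fin P.d) :
    ξ⁻¹ * |CxiT ξ (y.shift ν) y' - CxiT ξ y y'| ≤
        3037500 * ((ξ * (supDist y y' : ℝ)) ^ 2)⁻¹ * Real.exp (-(1 / 2 * (ξ * (supDist y y' : ℝ)))) ∧
      ξ⁻¹ * |CxiT ξ (y.unshift ν) y' - CxiT ξ y y'| ≤
        3037500 * ((ξ * (supDist y y' : ℝ)) ^ 2)⁻¹ * Real.exp (-(1 / 2 * (ξ * (supDist y y' : ℝ)))) ∧
      ξ⁻¹ * |CxiT ξ y (y'.shift ν) - CxiT ξ y y'| ≤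
        3037500 * ((ξ * (supDist y y' : ℝ)) ^ 2)⁻¹ * Real.exp (-(1 / 2 * (ξ * (supDist y y' : ℝ)))) ∧
      ξ⁻¹ * |CxiT ξ y (y'.unshift ν) - CxiT ξ y y'| ≤
        3037500 * ((ξ * (supDist y y' : ℝ)) ^ 2)⁻¹ * Real.exp (-(1 / 2 * (ξ * (supDist y y' : ℝ)))) := by
  have hξ0 : ξ ≠ 0 := hξ.ne'
  have hs : (0 : ℝ) < (supDist y y' : ℝ) := by
    have h0 : supDist y y' ≠ 0 := fun h0 => hne (((supDist_eq_zero_iff y y').mp h0).symm)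
    exact_mod_cast Nat.pos_of_ne_zero h0
  have hs0 : (supDist y y' : ℝ) ≠ 0 := hs.ne'
  -- the common conversion: ξ⁻¹·(B′_T·ξ·e/(ξs)²) ≤ 3037500·((ξs)²)⁻¹·e
  have conv : ∀ D : ℝ, |D| ≤ 900 * (1 + 2 / (1 - Real.exp (-(1 / 6)))) ^ 3 * ξ *
        (Real.exp (-(1 / 2 * (ξ * (supDist y y' : ℝ)))) / (ξ * (supDist y y' : ℝ)) ^ 2) →
      ξ⁻¹ * |D| ≤ 3037500 * ((ξ * (supDist y y' : ℝ)) ^ 2)⁻¹ * Real.exp (-(1 / 2 * (ξ * (supDist y y' : ℝ)))) := by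
    intro D hD
    have h0 : 0 ≤ ((ξ * (supDist y y' : ℝ)) ^ 2)⁻¹ * Real.exp (-(1 / 2 * (ξ * (supDist y y' : ℝ)))) := by positivity
    calc ξ⁻¹ * |D| ≤ ξ⁻¹ * (900 * (1 + 2 / (1 - Real.exp (-(1 / 6)))) ^ 3 * ξ *
          (Real.exp (-(1 / 2 * (ξ * (supDist y y' : ℝ)))) / (ξ * (supDist y y' : ℝ)) ^ 2)) :=
          mul_le_mul_of_nonneg_left hD (inv_pos.mpr hξ).le
      _ = 900 * (1 + 2 / (1 - Real.exp (-(1 / 6)))) ^ 3 *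
          (((ξ * (supDist y y' : ℝ)) ^ 2)⁻¹ * Real.exp (-(1 / 2 * (ξ * (supDist y y' : ℝ))))) := by
          field_simp
      _ ≤ 3037500 * (((ξ * (supDist y y' : ℝ)) ^ 2)⁻¹ * Real.exp (-(1 / 2 * (ξ * (supDist y y' : ℝ))))) :=
          mul_le_mul_of_nonneg_right derivTorusConst_le h0
      _ = _ := by ring
  exact ⟨conv _ (abs_CxiT_shift_sub_le hd hξ hξ1 hN hne ν), conv _ (abs_CxiT_unshift_sub_le hd hξ hξ1 hN hne ν),
    conv _ (abs_CxiT_shift_right_sub_le hd hξ hξ1 hN hne ν), conv _ (abs_CxiT_unshift_right_sub_le hd hξ hξ1 hN hne ν)⟩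

end Torus

end

end Literature.MathematicalPhysics.QuantumFieldTheory.Balaban1983to89.B3CxiTorusDerivativeBound
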